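import Summits.HodgeConjecture.HodgeConjecture.Theorems.Ring2AbelianAllSpreadBoxLeibniz
import Literature.AlgebraicGeometry.Milne1999.WeilClassStabilizer
import Literature.AlgebraicGeometry.HodgeTheory.EllipticCurvesProductsHodgeClassesOfRiemann
import Literature.AlgebraicTopology.SingularHomology.CupProductExteriorH1
import HarnessLib

/-!
# Ring 2 · AbelianAll · SPREADING, part XX — external products of degree-one classes on the self-powers
`A^{a+1}` are primitive for a box polarisation (second instalment of R2′ toward `(PL)`, fact-free)

research route, not a corollary; conditional on HC_CM plus one named minimal statement.
(Cell line: research route conditional on HC_CM; not a corollary; Q11.4-sentence-2 already refuted in dim ≥ 3.)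

HONEST FRAMING (page 1). Research route, not a corollary: the target of this line is HC for all complex abelian
varieties CONDITIONAL on `HC_CM` (`Summit…Theses.RankFourFaces.CMAbelianHodge`, a hypothesis) plus ONE named
minimal statement `B_min`; the `B_min` of record is unchanged by this file (least typed node N103
`EvenPrimitiveHodgeFailureSpreadsToCMFibre`, part XVI; "minimal" is claimed nowhere). This file proves, with no
new `def`, no `sorry` and no new named fact, the self-power form of part XIX's Leibniz rule — the geometric input
"(ii) + (iii)" of the DIAGONAL LIFT `(PL-Δ)` described in the seat's `SPREAD.md` §36 (the successor of the displayed
hypothesis `(PL)` of part XVII): a Hodge class `c ∈ H^{2p}(A)` is to be lifted along the `(2p)`-fold diagonal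
`Δ : A ⟶ A^{2p}` to the antisymmetrised external product of its degree-one factors, which is PRIMITIVE by the
pigeonhole below; nothing about that lift (linearity, `Δ^* ∘ Φ = id`, rationality, Hodge type) is proved here.

WHAT IS PROVED (all in `namespace Summit.HodgeConjecture.HodgeConjecture.Ring2.AbelianAll`; `A.powSucc a = A^{a+1}`
is the tree's recursive self-power `Motives/SupersingularAbelianVariety`, `powProj A a i : A^{a+1} ⟶ A` and
`powLift a G : B ⟶ A^{a+1}` are the projections / universal map of `Milne1999/WeilClassStabilizer`, and
`cupPowOne ℂ Y d w = w₀ ⌣ ⋯ ⌣ w_{d-1}` is the iterated cup product of `SingularHomology/CupProductExteriorH1`):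
* `cupPowOne_mem_primitiveClasses_sum` — PIGEONHOLE, single space, any coefficient ring: if `wᵢ ∈ P¹_{αᵢ}(n)` for
  every `i < d` then `w₀ ⌣ ⋯ ⌣ w_{d-1} ∈ P^d_{∑ αᵢ}(d·n)` (induction on `d` over part XIX's
  `cupProduct_mem_primitiveClasses_add`; the case `d = 0` is `1 ∈ P⁰_0(0)`).
* `cupPowOne_powProj_mem_primitiveClasses` — on `A^{a+1}`, for degree-one classes `v₀, …, v_a ∈ H¹(A)` and any
  `h ∈ H²(A)`: `pr₀^* v₀ ⌣ ⋯ ⌣ pr_a^* v_a ∈ P^{a+1}_{∑ prᵢ^* h}((a+1)·dim A)` (degree-one classes are primitive,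
  part XIX `mem_primitiveClasses_of_degree_one`, pulled back along the projections).
* `map_powLift_cupPowOne_powProj` — functoriality: `(G₀, …, G_a)^* (pr₀^* v₀ ⌣ ⋯ ⌣ pr_a^* v_a) = G₀^* v₀ ⌣ ⋯ ⌣ G_a^* v_a`
  on any `B`; with all `Gᵢ = 𝟙 A` this is the DIAGONAL identity `Δ^* (v₀ × ⋯ × v_a) = v₀ ⌣ ⋯ ⌣ v_a`
  (`map_diagonal_cupPowOne_powProj`).
* `exists_closedImmersion_powSucc_box` — by induction on `a` with the composite Segre embeddings of part XVIII: for a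
  closed immersion `e : A ⟶ ℙⁿ` and an additive family `g` of hyperplane classes (`exists_segreHyperplaneClasses`)
  there is a closed immersion `κ : A^{a+1} ⟶ ℙ^M`, `1 ≤ M`, with BOX class `κ^* g_M = ∑ᵢ prᵢ^* e^* g_n`.
* `exists_hardLefschetzNFold_powSucc_cupPowOne_mem_primitiveClasses` — ASSEMBLY: for `dim A ≥ 1` and every `a` there
  is a hard-Lefschetz datum `Λ` of `A^{a+1}` (in its dimension `(a+1)·dim A`, `dim_powSucc`) for which EVERY external
  product `pr₀^* v₀ ⌣ ⋯ ⌣ pr_a^* v_a` of degree-one classes of `A` is `Λ`-primitive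
  (`exists_hardLefschetzNFold_eq_smul_map` of part XVIII on `κ`, `primitiveClasses_smul` of part XIX).

André (1996, §1.3, p. 12) records the inclusion `P^i(X) ⊗ P^j(Y) ⊆ P^{i+j}(X × Y)` for the product polarisation; the
statements here are its iterated, degree-one special case, proved from the Leibniz rule rather than from
Clebsch–Gordan. [cite: Andre1996Motifs, §1.3 (p. 12)] [cite: VoisinHodgeI2002, §6.2.3 Def. 6.24 and Thm. 6.25]
[cite: HatcherAT2002, §3.2 Prop. 3.10 and Example 3.16] [cite: Hartshorne1977, II Ex. 5.11 and Ex. 5.12]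
-/

noncomputable section

set_option linter.dupNamespace false

open CategoryTheory MonoidalCategory AlgebraicGeometry
open Literature.AlgebraicTopology.SingularHomology Literature.Geometry.Kaehler
open Literature.AlgebraicGeometry Literature.AlgebraicGeometry.HodgeTheory Literature.AlgebraicGeometry.Motives
open Literature.AlgebraicGeometry.Motives.SegreHyperplaneClass
open Literature.AlgebraicGeometry.Milne1999

namespace Summit.HodgeConjecture.HodgeConjecture.Ring2.AbelianAll

universe u v

section SingleSpace

variable {Y : Type u} [TopologicalSpace Y] {R : Type v} [CommRing R]

/-- **Pigeonhole for iterated cup products (single space).** If `wᵢ ∈ P¹_{αᵢ}(n)` (`L_{αᵢ}^n wᵢ = 0`) for every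
`i < d`, then `w₀ ⌣ ⋯ ⌣ w_{d-1} ∈ P^d_{α₀ + ⋯ + α_{d-1}}(d·n)`, i.e. `L_{∑ αᵢ}^{d n - d + 1} (w₀ ⌣ ⋯ ⌣ w_{d-1}) = 0`:
expanding by the Leibniz rule, every monomial applies some `L_{αᵢ}` at least `n` times to `wᵢ`. Induction on `d`
over part XIX's `cupProduct_mem_primitiveClasses_add`. [cite: Andre1996Motifs, §1.3 (p. 12)]
[cite: VoisinHodgeI2002, §6.2.3 Def. 6.24 and Lemma 6.21] -/
theorem cupPowOne_mem_primitiveClasses_sum (n : ℕ) :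
    ∀ (d : ℕ) (α : Fin d → singularCohomology R R Y 2) (w : Fin d → singularCohomology R R Y 1),
      (∀ i, w i ∈ primitiveClasses (α i) n 1) →
        cupPowOne R Y d w ∈ primitiveClasses (∑ i, α i) (d * n) d
  | 0, α, w, _ => by
      rw [Fin.sum_univ_zero, zero_mul]
      refine ⟨fun h ↦ absurd h (lt_irrefl 0), fun r m h hr ↦ ?_⟩
      obtain rfl : r = 1 := by omega
      show lefschetzPowTo (0 : singularCohomology R R Y 2) (0 + 1) 0 m h _ = 0
      rw [← lefschetzPowTo_lefschetzOperator (0 : singularCohomology R R Y 2) 0 (rfl : 2 + 0 = 2) (by omega) h,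
        lefschetzOperator_apply, LinearMap.map_zero, LinearMap.zero_apply, map_zero]
  | d + 1, α, w, hw => by
      rw [cupPowOne_succ, Fin.sum_univ_succ, show (d + 1) * n = n + d * n by ring]
      exact cupProduct_mem_primitiveClasses_add (α 0) (∑ i : Fin d, α i.succ) n (d * n) (Nat.add_comm 1 d) (hw 0)
        (cupPowOne_mem_primitiveClasses_sum n d (fun i ↦ α i.succ) (Fin.tail w) fun i ↦ hw i.succ)

end SingleSpace

variable (A : AbelianVariety ℂ)

/-- **External products of degree-one classes on `A^{a+1}` are primitive for the box class.** For `dim A ≥ 1`,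
`h ∈ H²(A)` and `v₀, …, v_a ∈ H¹(A)`: `pr₀^* v₀ ⌣ ⋯ ⌣ pr_a^* v_a ∈ P^{a+1}_{∑ᵢ prᵢ^* h}((a+1)·dim A)` — each
`prᵢ^* vᵢ ∈ P¹_{prᵢ^* h}(dim A)` (a degree-one class of `A` is primitive since `H^{2 dim A + 1}(A) = 0`, part XIX,
pulled back along `prᵢ`), then the pigeonhole `cupPowOne_mem_primitiveClasses_sum`. [cite: Andre1996Motifs, §1.3 (p. 12)]
[cite: VoisinHodgeI2002, §6.2.3 Def. 6.24] -/
theorem cupPowOne_powProj_mem_primitiveClasses (hA : 1 ≤ A.dim) (h : complexBetti A.X 2) (a : ℕ)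
    (v : Fin (a + 1) → complexBetti A.X 1) :
    cupPowOne ℂ (Motives.ComplexPoints (A.powSucc a).X) (a + 1)
        (fun i ↦ complexBetti.map (powProj A a i).hom.hom.hom 1 (v i)) ∈
      primitiveClasses (∑ i, complexBetti.map (powProj A a i).hom.hom.hom 2 h) ((a + 1) * A.dim) (a + 1) :=
  cupPowOne_mem_primitiveClasses_sum A.dim (a + 1) _ _ fun i ↦
    mem_primitiveClasses_map _ h A.dim
      (mem_primitiveClasses_of_degree_one (AbelianVariety.isSmoothProjective_holds (A := A)) hA h (v i))

/-- **Functoriality of the external product along a tuple of homomorphisms.** For `G₀, …, G_a : B ⟶ A` with universal map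
`(G₀, …, G_a) : B ⟶ A^{a+1}` (`powLift`): `(G₀, …, G_a)^* (pr₀^* v₀ ⌣ ⋯ ⌣ pr_a^* v_a) = G₀^* v₀ ⌣ ⋯ ⌣ G_a^* v_a`
(naturality of cup products, `map_cupPowOne`, and `(G₀, …, G_a) ≫ prᵢ = Gᵢ`, `powLift_powProj`).
[cite: HatcherAT2002, §3.2 Prop. 3.10] -/
theorem map_powLift_cupPowOne_powProj {B : AbelianVariety ℂ} (a : ℕ) (G : Fin (a + 1) → (B ⟶ A))
    (v : Fin (a + 1) → complexBetti A.X 1) :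
    complexBetti.map (powLift a G).hom.hom.hom (a + 1)
        (cupPowOne ℂ (Motives.ComplexPoints (A.powSucc a).X) (a + 1)
          (fun i ↦ complexBetti.map (powProj A a i).hom.hom.hom 1 (v i))) =
      cupPowOne ℂ (Motives.ComplexPoints B.X) (a + 1) (fun i ↦ complexBetti.map (G i).hom.hom.hom 1 (v i)) := by
  refine (map_cupPowOne _ (a + 1) _).trans ?_
  congr 1
  funext i
  show complexBetti.map (powLift a G).hom.hom.hom 1 (complexBetti.map (powProj A a i).hom.hom.hom 1 (v i)) = _
  rw [← map_comp_apply']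
  change complexBetti.map (powLift a G ≫ powProj A a i).hom.hom.hom 1 (v i) = _
  rw [powLift_powProj]

/-- **The diagonal identity.** With `Δ := (𝟙, …, 𝟙) : A ⟶ A^{a+1}` the `(a+1)`-fold diagonal,
`Δ^* (pr₀^* v₀ ⌣ ⋯ ⌣ pr_a^* v_a) = v₀ ⌣ ⋯ ⌣ v_a` in `H^{a+1}(A)`. [cite: HatcherAT2002, §3.2 Prop. 3.10 and Example 3.16] -/
theorem map_diagonal_cupPowOne_powProj (a : ℕ) (v : Fin (a + 1) → complexBetti A.X 1) :
    complexBetti.map (powLift a fun _ : Fin (a + 1) ↦ 𝟙 A).hom.hom.hom (a + 1)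
        (cupPowOne ℂ (Motives.ComplexPoints (A.powSucc a).X) (a + 1)
          (fun i ↦ complexBetti.map (powProj A a i).hom.hom.hom 1 (v i))) =
      cupPowOne ℂ (Motives.ComplexPoints A.X) (a + 1) v := by
  rw [map_powLift_cupPowOne_powProj]
  congr 1
  funext i
  change complexBetti.map (𝟙 A.X) 1 (v i) = v i
  rw [complexBetti.map_id]
  rfl

/-- **Box embeddings of the self-powers (induction on Segre embeddings).** Given a closed immersion `e : A ⟶ ℙⁿ`, `n ≥ 1`,
and a family `g_N ∈ H²(ℙ^N)` additive under the Segre maps (`σ^* g_{nm+n+m} = pr₁^* g_n + pr₂^* g_m`,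
`exists_segreHyperplaneClasses`), every self-power `A^{a+1}` carries a closed immersion `κ : A^{a+1} ⟶ ℙ^M`, `M ≥ 1`,
whose hyperplane class is the BOX class: `κ^* g_M = ∑ᵢ prᵢ^* (e^* g_n)`. Step: `A^{a+2} = A^{a+1} × A`,
`κ' := (κ ⊗ e) ≫ σ`. [cite: Hartshorne1977, II Ex. 5.11 and Ex. 5.12] [cite: VoisinHodgeI2002, §7.1.2] -/
theorem exists_closedImmersion_powSucc_box (g : (N : ℕ) → complexBetti (projectiveSpace N ℂ) 2)
    (hsegre : ∀ n m : ℕ, complexBetti.map (segreEmbedding n m ℂ) 2 (g (n * m + n + m)) =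
        complexBetti.map (CartesianMonoidalCategory.fst (projectiveSpace n ℂ) (projectiveSpace m ℂ)) 2 (g n) +
          complexBetti.map (CartesianMonoidalCategory.snd (projectiveSpace n ℂ) (projectiveSpace m ℂ)) 2 (g m))
    {n : ℕ} (hn : 1 ≤ n) (e : A.X ⟶ projectiveSpace n ℂ) [he : IsClosedImmersion e.left] :
    ∀ a : ℕ, ∃ (M : ℕ) (κ : (A.powSucc a).X ⟶ projectiveSpace M ℂ), 1 ≤ M ∧ IsClosedImmersion κ.left ∧
      complexBetti.map κ 2 (g M) = ∑ i, complexBetti.map (powProj A a i).hom.hom.hom 2 (complexBetti.map e 2 (g n))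
  | 0 => by
      refine ⟨n, e, hn, he, ?_⟩
      rw [Fin.sum_univ_one, powProj_zero]
      change _ = complexBetti.map (𝟙 A.X) 2 (complexBetti.map e 2 (g n))
      rw [complexBetti.map_id]
      rfl
  | a + 1 => by
      obtain ⟨M, κ, hM, hκci, hκ⟩ := exists_closedImmersion_powSucc_box g hsegre hn e a
      haveI := hκci
      haveI := isClosedImmersion_tensorHom_left (X := (A.powSucc a).X) (Y := A.X) κ e
      refine ⟨M * n + M + n, (show (A.powSucc (a + 1)).X ⟶ projectiveSpace (M * n + M + n) ℂ from
        (κ ⊗ₘ e) ≫ segreEmbedding M n ℂ), le_trans hn (Nat.le_add_left _ _), ?_, ?_⟩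
      · change IsClosedImmersion ((κ ⊗ₘ e).left ≫ (segreEmbedding M n ℂ).left)
        infer_instance
      · change complexBetti.map ((κ ⊗ₘ e) ≫ segreEmbedding M n ℂ) 2 (g (M * n + M + n)) = _
        rw [map_comp_apply', hsegre, map_add, map_tensorHom_map_fst, map_tensorHom_map_snd, hκ, map_sum]
        conv_rhs => rw [Fin.sum_univ_castSucc]
        refine congrArg₂ (· + ·) (Finset.sum_congr rfl fun i _ ↦ ?_) ?_
        · rw [powProj_succ_castSucc]
          exact (map_comp_apply' (powFst A a).hom.hom.hom (powProj A a i).hom.hom.hom 2 _).symm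
        · rw [powProj_succ_last]
          rfl

/-- **ASSEMBLY — a box hard-Lefschetz datum on `A^{a+1}` for which all external products of degree-one classes are
primitive.** For a complex abelian variety `A` of positive dimension and every `a` there is a hard-Lefschetz datum `Λ` of
the self-power `A^{a+1}` (dimension `(a+1)·dim A`) such that `pr₀^* v₀ ⌣ ⋯ ⌣ pr_a^* v_a` is `Λ`-primitive for ALL
`v₀, …, v_a ∈ H¹(A)`: `Λ` is part XVIII's `exists_hardLefschetzNFold_eq_smul_map` on the box embedding
`exists_closedImmersion_powSucc_box` (`Λ.hyperplaneClass = t • ∑ prᵢ^* h`, `t ≠ 0`, primitivity is insensitive to `t`,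
part XIX `primitiveClasses_smul`), and primitivity is `cupPowOne_powProj_mem_primitiveClasses`. This is the geometric
half of the diagonal lift `(PL-Δ)`; HC_CM is not mentioned and the `B_min` of record is unchanged.
[cite: Andre1996Motifs, §1.3 (p. 12)] [cite: VoisinHodgeI2002, Thm. 6.25 and §7.1.2] [cite: Hartshorne1977, II Ex. 5.11 and Ex. 5.12] -/
theorem exists_hardLefschetzNFold_powSucc_cupPowOne_mem_primitiveClasses (hA : 1 ≤ A.dim) (a : ℕ) :
    ∃ Λ : HardLefschetzNFold (A.powSucc a).dim (A.powSucc a).X,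
      ∀ v : Fin (a + 1) → complexBetti A.X 1,
        cupPowOne ℂ (Motives.ComplexPoints (A.powSucc a).X) (a + 1)
            (fun i ↦ complexBetti.map (powProj A a i).hom.hom.hom 1 (v i)) ∈
          primitiveClasses Λ.hyperplaneClass (A.powSucc a).dim (a + 1) := by
  have hX : IsSmoothProjective (A.powSucc a).dim (A.powSucc a).X := AbelianVariety.isSmoothProjective_holds
  obtain ⟨n, e, hn, he⟩ := exists_closedImmersion_projectiveSpace_pos A
  haveI := he
  obtain ⟨g, -, hg0, hsegre⟩ := exists_segreHyperplaneClasses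
  obtain ⟨M, κ, hM, hκci, hκ⟩ := exists_closedImmersion_powSucc_box A g hsegre hn e a
  haveI := hκci
  have hdim : 1 ≤ (A.powSucc a).dim := by
    rw [dim_powSucc]
    exact le_trans hA (Nat.le_mul_of_pos_left _ (Nat.succ_pos a))
  obtain ⟨Λ, t, ht, hΛ⟩ := exists_hardLefschetzNFold_eq_smul_map hX hdim κ (hg0 M hM)
  refine ⟨Λ, fun v ↦ ?_⟩
  rw [hΛ, primitiveClasses_smul _ _ _ ht, hκ, dim_powSucc]
  exact cupPowOne_powProj_mem_primitiveClasses A hA _ a v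

end Summit.HodgeConjecture.HodgeConjecture.Ring2.AbelianAll
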